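import Mathlib

/-!
# Reflexive–transitive closure of a symmetric relation as graph reachability (decidable)

For a symmetric relation `r`, `Relation.ReflTransGen r a b` is reachability in the simple graph
`SimpleGraph.fromRel r` (`reflTransGen_iff_reachable_fromRel`).  On a finite type with `r` decidable
this is decidable (Mathlib's `DecidableRel (fromRel r).Reachable`), so closure statements about
concrete Boolean matrices on `Fin 4` are settled by `decide`, including statements quantified over
all assignments of a few Boolean parameters (the shape of the automaton step of the graph half).
-/

namespace PercRepro

/-- **Symmetric closure = reachability.** -/
theorem reflTransGen_iff_reachable_fromRel {α : Type*} {r : α → α → Prop}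
    (hr : ∀ x y, r x y → r y x) (a b : α) :
    Relation.ReflTransGen r a b ↔ (SimpleGraph.fromRel r).Reachable a b := by
  rw [SimpleGraph.reachable_iff_reflTransGen]
  constructor
  · intro h
    induction h with
    | refl => exact Relation.ReflTransGen.refl
    | @tail x y _ hxy ih =>
      by_cases hxy' : x = y
      · subst hxy'; exact ih
      · exact ih.tail ((SimpleGraph.fromRel_adj r x y).mpr ⟨hxy', Or.inl hxy⟩)
  · intro h
    induction h with
    | refl => exact Relation.ReflTransGen.refl
    | @tail x y _ hxy ih =>
      rcases ((SimpleGraph.fromRel_adj r x y).mp hxy).2 with h' | h'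
      · exact ih.tail h'
      · exact ih.tail (hr _ _ h')

/-- Reachability in the graph of a Boolean matrix on `Fin 4` (the shape used by the automaton). -/
def reach4 (m : Fin 4 → Fin 4 → Bool) (a b : Fin 4) : Prop :=
  (SimpleGraph.fromRel fun i j => m i j = true).Reachable a b

/-- `reach4` is decidable (Mathlib's decidable reachability on a finite graph). -/
instance (m : Fin 4 → Fin 4 → Bool) (a b : Fin 4) : Decidable (reach4 m a b) := by
  unfold reach4; infer_instance

/-- A closure statement on a concrete matrix is settled by `decide`: the path `0 – 1 – 3`. -/
example : reach4 (fun i j => (i = 0 ∧ j = 1) ∨ (i = 1 ∧ j = 3)) 0 3 := by decide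

/-- … and so is its negation: no path from `0` to `2`. -/
example : ¬ reach4 (fun i j => (i = 0 ∧ j = 1) ∨ (i = 1 ∧ j = 3)) 0 2 := by decide

/-- The automaton shape: a matrix whose entries depend on a few Boolean facts, and a closed-form
formula for reachability, checked for EVERY assignment of the facts by `decide`
(here: `c` reaches `a` iff `t 0 ∨ (t 1 ∧ t 2)` for the matrix with edges `c–a` [t 0], `c–x` [t 1],
`x–a` [t 2], `x–b` [t 3]; vertices `a b c x = 0 1 2 3`). -/
example : ∀ t : Fin 4 → Bool,
    reach4 (fun i j => ((i = 2 ∧ j = 0) ∧ t 0) ∨ ((i = 2 ∧ j = 3) ∧ t 1) ∨ ((i = 3 ∧ j = 0) ∧ t 2) ∨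
      ((i = 3 ∧ j = 1) ∧ t 3)) 2 0 ↔ (t 0 ∨ (t 1 ∧ t 2)) = true := by
  decide

end PercRepro

namespace PercRepro

/-- The largest shape of the graph half: six edge facts on the complete graph of `a b c x` and the
reachability `a → b` in closed form, all 64 assignments by `decide`. -/
example : ∀ t : Fin 6 → Bool,
    reach4 (fun i j => ((i = 0 ∧ j = 1) ∧ t 0) ∨ ((i = 0 ∧ j = 2) ∧ t 1) ∨ ((i = 0 ∧ j = 3) ∧ t 2) ∨
      ((i = 1 ∧ j = 2) ∧ t 3) ∨ ((i = 1 ∧ j = 3) ∧ t 4) ∨ ((i = 2 ∧ j = 3) ∧ t 5)) 0 1 ↔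
      (t 0 ∨ (t 1 ∧ t 3) ∨ (t 2 ∧ t 4) ∨ (t 1 ∧ t 5 ∧ t 4) ∨ (t 2 ∧ t 5 ∧ t 3)) = true := by
  decide

end PercRepro
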